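import Literature.Analysis.PDE.QuasilinearLinearization
import Literature.Analysis.PDE.PosDefInvSqrt
import Literature.Geometry.Manifold.PatchSystem
import HarnessLib

/-!
# The adapted patch system of a quasilinear system at the initial map (topic `Analysis/PDE`)

Layer (III), step 2b, of the programme to prove short-time existence for quasilinear strictly
parabolic systems on a closed manifold (hypothesis `hQL` of
`Literature.Geometry.Riemannian.ricciFlow_shortTime_existence_of_quasilinear`). The linear
theory of layer (II) (`linear_apriori_residual_le`, `exists_linSolution`) requires the symbol
field of the operator to be `η`-close to the identity on every patch, `16 n³ η² ≤ 1`. For the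
linearisation `L = DP(u₀)` this is arranged by the choice of the patch system: the frame of the
chart centred at `z` is `N_z ∘ A₀` with `N_z = S₀(z)^{-1/2}` (`exists_invSqrt`), which makes the
symbol the identity at the centre (`linSymb_centre_eq_one`), and the radii are taken so small
that the symbol stays `η`-close to the identity on `closedBall 0 (4 rₚ)` (continuity); the patch
system is then provided by `exists_patchSystem`.

* `centreJet`, `linSymb_centred_zero` — the symbol at the centre of a centred framed chart is
  the symbol operator of the frame-independent centre coefficients;
* `symbOp_trans` — change of frame: `symbOp (N ∘ A₀) α = N ∘ symbOp A₀ α ∘ N` for self-adjoint `N`;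
* `exists_adapted_patchSystem` — **the adapted patch system**.

Everything is proved; no named fact and no `sorry` is introduced.

## References

* C. Mantegazza, L. Martinazzi, *A note on quasilinear parabolic equations on manifolds*,
  Ann. Sc. Norm. Super. Pisa Cl. Sci. (5) 11 (2012), 857–874, §2. [MantegazzaMartinazzi2012]
* J. M. Lee, *Introduction to Smooth Manifolds*, 2nd ed., Springer 2013, Thm. 2.23. [Lee2013]
-/

noncomputable section

open Set Function Filter Topology Metric InnerProductSpace
open scoped Manifold ContDiff Topology RealInnerProductSpace

namespace Literature.Analysis.PDE

open Literature.Geometry.Manifold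

variable {E : Type*} [NormedAddCommGroup E] [NormedSpace ℝ E] {H : Type*} [TopologicalSpace H]
variable {I : ModelWithCorners ℝ E H} {M : Type*} [TopologicalSpace M] [ChartedSpace H M]
variable {E' : Type*} [NormedAddCommGroup E'] [InnerProductSpace ℝ E'] [FiniteDimensional ℝ E']
variable {W : Type*} [NormedAddCommGroup W] [NormedSpace ℝ W]
variable {ι : Type*} [Fintype ι] (b : Module.Basis ι ℝ E)
  (a : M → E × W × (E →L[ℝ] W) → ι → ι → ℝ) (u₀ : M → W)

/-! ### The symbol at the centre of a centred chart -/

/-- **The centre jet** of `u₀` at `z` in the extended chart: `(φ z, u₀ z, D(u₀ ∘ φ⁻¹)(φ z))`,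
`φ = extChartAt I z` (frame-independent). [cite: MantegazzaMartinazzi2012, §2] -/
def centreJet (z : M) : E × W × (E →L[ℝ] W) := (extChartAt I z z, u₀ z, fderiv ℝ (u₀ ∘ (extChartAt I z).symm) (extChartAt I z z))

variable {b a u₀}

omit [FiniteDimensional ℝ E'] in
/-- **The symbol at the centre of a centred framed chart** is the symbol operator of the centre
coefficients: `linSymb (centred I A z) 0 = symbOp (centred I A z) (a z (centreJet z))`, provided
`û₀` is differentiable at `0`. [cite: MantegazzaMartinazzi2012, §2] -/
theorem linSymb_centred_zero (A : E ≃L[ℝ] E') (z : M)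
    (hd : DifferentiableAt ℝ (u₀ ∘ (FramedChart.centred I A z).inv) 0) :
    linSymb (FramedChart.centred I A z) b a u₀ 0 = symbOp (FramedChart.centred I A z) b fun i i' ↦ a z (centreJet (I := I) u₀ z) i i' := by
  set κ := FramedChart.centred I A z with hκ
  have hz : κ.z = z := rfl
  have h0 : κ.affine (extChartAt I z z) = 0 := by
    rw [FramedChart.affine_apply]
    show A (extChartAt I z z) + (-A (extChartAt I z z)) = 0
    exact add_neg_cancel _
  -- the base jet at `0` pulled back is the centre jet
  have hjet : κ.jetBack 0 (baseJet κ u₀ 0).1 (baseJet κ u₀ 0).2 = centreJet (I := I) u₀ z := by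
    rw [FramedChart.jetBack_apply, centreJet]
    have h1 : κ.A.symm (0 - κ.c) = extChartAt I z z := by
      show A.symm (0 - -A (extChartAt I z z)) = extChartAt I z z
      rw [zero_sub, neg_neg, ContinuousLinearEquiv.symm_apply_apply]
    have h2 : (baseJet κ u₀ 0).1 = u₀ z := by
      show u₀ (κ.inv 0) = u₀ z
      rw [← h0, κ.inv_affine, hz, extChartAt_to_inv]
    have h3 : (baseJet κ u₀ 0).2 ∘L (κ.A : E →L[ℝ] E') = fderiv ℝ (u₀ ∘ (extChartAt I z).symm) (extChartAt I z z) := by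
      show fderiv ℝ (u₀ ∘ κ.inv) 0 ∘L (κ.A : E →L[ℝ] E') = _
      have h := κ.fderiv_comp_extChartAt_symm u₀ (η := extChartAt I z z) (by rwa [h0])
      rw [h0] at h
      rw [hz] at h
      exact h.symm
    rw [h1, h2, h3]
  show symbOp κ b (fun i i' ↦ a κ.z (κ.jetBack 0 (baseJet κ u₀ 0).1 (baseJet κ u₀ 0).2) i i') = _
  rw [hjet]
  rfl

omit [FiniteDimensional ℝ E'] in
/-- **Change of frame for the symbol operator**: with the frame `N ∘ A₀` in place of `A₀` and
`N` self-adjoint, `symbOp (N ∘ A₀) α = N ∘ symbOp A₀ α ∘ N`. [folklore] -/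
theorem symbOp_trans (A₀ : E ≃L[ℝ] E') (N : E' ≃L[ℝ] E') (hN : ∀ ξ ζ : E', ⟪(N : E' →L[ℝ] E') ξ, ζ⟫ = ⟪ξ, (N : E' →L[ℝ] E') ζ⟫)
    (z : M) (α : ι → ι → ℝ) :
    symbOp (FramedChart.centred I (A₀.trans N) z) b α = (N : E' →L[ℝ] E') ∘L symbOp (FramedChart.centred I A₀ z) b α ∘L (N : E' →L[ℝ] E') := by
  ext ξ
  simp only [symbOp_apply, ContinuousLinearMap.coe_comp, Function.comp_apply, map_sum, map_smul]
  refine Finset.sum_congr rfl fun i _ ↦ Finset.sum_congr rfl fun i' _ ↦ ?_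
  show α i i' • (⟪N (A₀ (b i')), ξ⟫ • N (A₀ (b i))) = α i i' • (⟪A₀ (b i'), N ξ⟫ • N (A₀ (b i)))
  rw [show ⟪N (A₀ (b i')), ξ⟫ = ⟪A₀ (b i'), N ξ⟫ from hN _ _]

/-! ### The adapted patch system -/

omit [FiniteDimensional ℝ E'] in
/-- The centre of a centred framed chart is mapped to `0`, which lies in the target. [folklore] -/
theorem zero_mem_target_centred (A : E ≃L[ℝ] E') (z : M) : (0 : E') ∈ (FramedChart.centred I A z).target := by
  have h := (FramedChart.centred I A z).map_mem_target (FramedChart.centred I A z).mem_source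
  rwa [show (FramedChart.centred I A z).z = z from rfl, FramedChart.centred_map_base] at h

/-- **Existence of the adapted patch system.** Let `M` be compact without boundary, the
coefficients `a z` smooth, symmetric and positive definite on the extended-chart jet domains
(structure hypotheses of `hQL`), `u₀` smooth with graph in the open set `𝒪`, `A₀ : E ≃L E'` a
reference frame and `η > 0`. Then there is a patch system whose charts are centred framed charts
with frames `N ∘ A₀` such that the symbol field of the linearisation at `u₀` is `η`-close to the
identity on `closedBall 0 (4 rₚ)` for every patch `p`. [cite: MantegazzaMartinazzi2012, §2] -/
theorem exists_adapted_patchSystem [CompactSpace M] [I.Boundaryless] [IsManifold I ∞ M] (A₀ : E ≃L[ℝ] E') {𝒪 : Set (M × W)}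
    (ha : ∀ z i i', ContDiffOn ℝ ∞ (fun j ↦ a z j i i') {j | j.1 ∈ (extChartAt I z).target ∧ ((extChartAt I z).symm j.1, j.2.1) ∈ 𝒪})
    (hstruct : ∀ z (j : E × W × (E →L[ℝ] W)), j.1 ∈ (extChartAt I z).target → ((extChartAt I z).symm j.1, j.2.1) ∈ 𝒪 →
      (∀ i i', a z j i i' = a z j i' i) ∧ ∀ ξ : ι → ℝ, ξ ≠ 0 → 0 < ∑ i, ∑ i', a z j i i' * ξ i * ξ i')
    (hu₀ : ContMDiff I 𝓘(ℝ, W) ∞ u₀) (hg₀ : ∀ x, (x, u₀ x) ∈ 𝒪) {η : ℝ} (hη : 0 < η) :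
    ∃ (t : Finset M) (P : PatchSystem I M E' ↥t),
      (∀ p : ↥t, ∃ N : E' ≃L[ℝ] E', P.chart p = FramedChart.centred I (A₀.trans N) (p : M)) ∧
      ∀ p : ↥t, ∀ y ∈ closedBall (0 : E') (4 * P.r p), ‖linSymb (P.chart p) b a u₀ y - 1‖ ≤ η := by
  classical
  -- the graph condition in every centred chart
  have hg : ∀ (A : E ≃L[ℝ] E') (z : M), ∀ y ∈ (FramedChart.centred I A z).target,
      ((FramedChart.centred I A z).inv y, u₀ ((FramedChart.centred I A z).inv y)) ∈ 𝒪 := fun A z y _ ↦ hg₀ _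
  have huh : ∀ (A : E ≃L[ℝ] E') (z : M), ContDiffOn ℝ ∞ (u₀ ∘ (FramedChart.centred I A z).inv) (FramedChart.centred I A z).target :=
    fun A z ↦ (FramedChart.centred I A z).contDiffOn_comp_inv hu₀
  have hd0 : ∀ (A : E ≃L[ℝ] E') (z : M), DifferentiableAt ℝ (u₀ ∘ (FramedChart.centred I A z).inv) 0 := fun A z ↦
    ((huh A z).differentiableOn (by simp)).differentiableAt ((FramedChart.centred I A z).isOpen_target.mem_nhds (zero_mem_target_centred A z))
  -- Step 1: the symbol at the centre in the reference frame, and its inverse square root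
  set α : M → ι → ι → ℝ := fun z i i' ↦ a z (centreJet (I := I) u₀ z) i i' with hα
  set S₀ : M → (E' →L[ℝ] E') := fun z ↦ symbOp (FramedChart.centred I A₀ z) b (α z) with hS₀
  have hS₀prop : ∀ z, (∀ ξ ζ : E', ⟪S₀ z ξ, ζ⟫ = ⟪ξ, S₀ z ζ⟫) ∧ ∀ ξ : E', ξ ≠ 0 → 0 < ⟪S₀ z ξ, ξ⟫ := by
    intro z
    have h := adjoint_linSymb_and_pos (κ := FramedChart.centred I A₀ z) (b := b) (a := a) (u₀ := u₀) (hstruct z) (hg A₀ z)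
      (zero_mem_target_centred A₀ z)
    rw [linSymb_centred_zero A₀ z (hd0 A₀ z)] at h
    obtain ⟨hadj, hpos⟩ := h
    refine ⟨fun ξ ζ ↦ ?_, hpos⟩
    show ⟪symbOp (FramedChart.centred I A₀ z) b (α z) ξ, ζ⟫ = ⟪ξ, symbOp (FramedChart.centred I A₀ z) b (α z) ζ⟫
    rw [← ContinuousLinearMap.adjoint_inner_right, hadj]
  choose N hNsa hNSN using fun z ↦ exists_invSqrt (hS₀prop z).1 (hS₀prop z).2
  -- Step 2: the frames and the symbol `= 1` at the centres
  set A : M → (E ≃L[ℝ] E') := fun z ↦ A₀.trans (N z) with hA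
  have hcentre : ∀ z, linSymb (FramedChart.centred I (A z) z) b a u₀ 0 = 1 := by
    intro z
    rw [linSymb_centred_zero (A z) z (hd0 (A z) z), show A z = A₀.trans (N z) from rfl, symbOp_trans (b := b) A₀ (N z) (hNsa z) z]
    exact hNSN z
  -- Step 3: radii by continuity
  have hρ : ∀ z, ∃ ρ : ℝ, 0 < ρ ∧ ∀ y ∈ closedBall (0 : E') (4 * ρ), ‖linSymb (FramedChart.centred I (A z) z) b a u₀ y - 1‖ ≤ η := by
    intro z
    set κ := FramedChart.centred I (A z) z with hκ
    have hsm : ContDiffOn ℝ ∞ (linSymb κ b a u₀) κ.target := contDiffOn_linSymb (ha z) (huh (A z) z) (hg (A z) z)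
    have hc : ContinuousAt (linSymb κ b a u₀) 0 := hsm.continuousOn.continuousAt (κ.isOpen_target.mem_nhds (zero_mem_target_centred (A z) z))
    obtain ⟨ρ₀, hρ₀, hball⟩ := Metric.continuousAt_iff.1 hc η hη
    refine ⟨ρ₀ / 8, by positivity, fun y hy ↦ ?_⟩
    have hy' : dist y 0 < ρ₀ := by
      rw [dist_zero_right]
      have h := mem_closedBall_zero_iff.1 hy
      linarith
    have h := hball hy'
    rw [dist_eq_norm, hcentre z] at h
    exact h.le
  choose ρ hρ0 hρb using hρ
  -- Step 4: the patch system
  obtain ⟨t, P, hP⟩ := exists_patchSystem (I := I) (M := M) A ρ hρ0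
  refine ⟨t, P, fun p ↦ ⟨N p, (hP p).1⟩, fun p y hy ↦ ?_⟩
  rw [(hP p).1]
  refine hρb p y (closedBall_subset_closedBall ?_ hy)
  linarith [(hP p).2]


end Literature.Analysis.PDE
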